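import Summits.HodgeConjecture.HodgeConjecture.Theorems.Ring2AbelianAllAndreCorrespondenceCategory
import Summits.HodgeConjecture.HodgeConjecture.Theorems.Ring2AbelianAllAndreLiebermanHolds
import Literature.AlgebraicGeometry.HodgeTheory.LefschetzDecompositionSingular
import Literature.AlgebraicGeometry.HodgeTheory.HodgeSectionRestrictionPairing
import Literature.AlgebraicGeometry.HodgeTheory.MotivatedClassesAlgebraic
import HarnessLib

/-!
# Ring 2 · sub-cell AbelianAll, André axis, part XXII-g — THE LEFSCHETZ-PRIMITIVE PROJECTOR OF A COMPLEX ABELIAN VARIETY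
# IS AN ALGEBRAIC CORRESPONDENCE (Kleiman §1.4 / André Prop. 1.2 for abelian varieties, on the real carriers)

HONEST FRAMING (page 1, verbatim): **research route, not a corollary; conditional on HC_CM plus one named
minimal statement.** Cell line: research route conditional on HC_CM; not a corollary; Q11.4-sentence-2
already refuted in dim ≥ 3. Nothing in this file proves a case of the Hodge conjecture; `HC_CM` does not occur.
Seat `pub-hodge-ring2-ab-andre-2`, gen 14. REFEREE-AB's forward notice on XXII-c (R-51): "`*_L` additionally needs the
Lefschetz-primitive PROJECTORS (polynomials in `L` and the inverses — Kleiman §1.4 / André Prop. 1.2 `ℚ[L, *_L] = ℚ[L, Λ]`)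
to be algebraic too". The tree's `StandardConjectureBStar` does not contain that clause (it is `*_L` degree by degree); this
file PROVES the clause for complex abelian varieties, as a consequence of part XXII-c: for `A` of dimension `g`, a
polarisation class `η`, and a degree `i = a + 2 ≤ g`, the projector of `Hⁱ(A(ℂ); ℂ) = Pⁱ ⊕ L H^{i-2}` onto the
`η`-primitive classes `Pⁱ = ker L^{g-i+1}` along `L H^{i-2}` is

  `Π = id − L ∘ θ ∘ L^{g-i+1}`,  `θ = (L^{g-i+2})⁻¹ : H^{2g-i+2} → H^{i-2}` the Lefschetz involution above the middle,

a difference of compositions of algebraic correspondences (`L`-powers: cup with the algebraic `ηʲ`; `θ`: Lieberman, part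
XXII-c; composition and differences: part XXII-e), hence an algebraic correspondence (`IsAlgebraicCorrespondence g g A A Π`),
with `Π x = x` for `x ∈ Pⁱ` and `Π (L y) = 0` for `y ∈ H^{i-2}`. Iterating in `L H^{i-2} = L P^{i-2} ⊕ L² H^{i-4}` gives all
Lefschetz components; only the top projector is recorded here. In the pencil language of parts XII/XXI (`κ = j_t^*K`): the
primitive projection of the FIBRE `X_t` used in `exists_primitivePart_map_fiberι_eq` is algebraic — so the primitive parts of
ALGEBRAIC classes of the fibre are algebraic for operator reasons, not only through `A(X_t, κ)` (part XVIII-d).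

## What is proved (theorems only; no definition, no named fact, no sorry)

§1 `isAlgebraicCorrespondence_id`, `isAlgebraicCorrespondence_lefschetzPowTo` (general smooth projective `X`, algebraic `η`);
§2 **`exists_primitiveProjector_abelianVariety`**. EDGE LABELS: all K. References: Kleiman1968AlgebraicCycles (§1.4, §2, App.
2A11); Andre1996Motifs (§1.1, Prop. 1.2 (p. 11), §2.1); VoisinHodgeI2002 (§6.2.3 Def. 6.24, Cor. 6.26); Lieberman1968.
-/

noncomputable section

set_option linter.dupNamespace false

namespace Summit.HodgeConjecture.HodgeConjecture.Ring2.AbelianAll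

open CategoryTheory AlgebraicGeometry MonoidalCategory CartesianMonoidalCategory
open Literature.AlgebraicGeometry Literature.AlgebraicGeometry.Motives
open Literature.AlgebraicGeometry.HodgeTheory
open Literature.AlgebraicTopology.SingularHomology (singularCohomology cupProduct)
open Literature.Geometry.Kaehler (lefschetzPow lefschetzOperator HasHardLefschetzProperty)

variable {n : ℕ} {X : SchemeOver ℂ}

/-! ## §1 Identity and Lefschetz powers as algebraic correspondences -/

/-- **The identity of `Hᵃ(X(ℂ); ℂ)` is an algebraic correspondence** (the diagonal; the tree's `isAlgebraicCorrespondence_map`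
for `𝟙 X`), `a ≤ 2 dim X`. [cite: Andre1996Motifs, §2.1 (p. 15)] -/
theorem isAlgebraicCorrespondence_id (hX : IsSmoothProjective n X) {a : ℕ} (ha : a ≤ 2 * n) :
    IsAlgebraicCorrespondence n n X X (LinearMap.id : complexBetti X a →ₗ[ℂ] complexBetti X a) := by
  have h := isAlgebraicCorrespondence_map hX hX (𝟙 X) ha
  rwa [complexBetti.map_id] at h

/-- **Every Lefschetz power `Lʲ_η : Hᵏ(X(ℂ)) → Hᵐ(X(ℂ))` of an algebraic class `η ∈ N¹ H²(X(ℂ))` is an algebraic correspondence**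
(`m = k + 2j ≤ 2 dim X`): `id ∘ Lʲ` with part XXII-e's `IsAlgebraicCorrespondence.comp_lefschetzPow` (the class is `Δ_* ηʲ`).
[cite: VoisinHodgeII2003, §9.2.4 Prop. 9.20] [cite: Andre1996Motifs, §2.1 (p. 15)] -/
theorem isAlgebraicCorrespondence_lefschetzPowTo (hX : IsSmoothProjective n X) {η : complexBetti X 2}
    (hη : η ∈ algebraicClasses X 1) (j k m : ℕ) (hm : k + 2 * j = m) (hmn : m ≤ 2 * n) :
    IsAlgebraicCorrespondence n n X X (lefschetzPowTo η j k m hm) := by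
  subst hm
  have h := IsAlgebraicCorrespondence.comp_lefschetzPow hX hX hη k j
    (T := (LinearMap.id : complexBetti X (k + 2 * j) →ₗ[ℂ] complexBetti X (k + 2 * j))) (isAlgebraicCorrespondence_id hX hmn)
  rwa [LinearMap.id_comp] at h

/-! ## §2 The primitive projector of a complex abelian variety is algebraic -/

/-- **THE `η`-PRIMITIVE PROJECTOR OF A COMPLEX ABELIAN VARIETY IS AN ALGEBRAIC CORRESPONDENCE.** For a complex abelian variety
`A` of dimension `g`, a polarisation class `η`, and `a + 2 + k = g` (degree `i = a + 2 ≤ g`): there is a `ℂ`-linear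
`Π : Hⁱ(A(ℂ); ℂ) → Hⁱ(A(ℂ); ℂ)`, induced by an algebraic class on `A × A`, which is the identity on the `η`-primitive classes
`Pⁱ = ker (L^{k+1} : Hⁱ → H^{2g-i+2})` and kills `L H^{i-2}` — the projector of the Lefschetz decomposition `Hⁱ = Pⁱ ⊕ L H^{i-2}`
onto its primitive summand. Formula: `Π = id − L ∘ *_L ∘ L^{k+1}` with `*_L = (L^{k+2})⁻¹ : H^{a+2(k+2)} → Hᵃ` algebraic by
Lieberman (part XXII-c), the `L`-powers algebraic (§1), compositions and differences algebraic (part XXII-e).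
[cite: Kleiman1968AlgebraicCycles, §1.4 and Appendix to §2, Thm. 2A11] [cite: Andre1996Motifs, §1.1 (p. 10) and Prop. 1.2 (p. 11)]
[cite: VoisinHodgeI2002, §6.2.3 Def. 6.24 and Cor. 6.26] [cite: Lieberman1968, main theorem] -/
theorem exists_primitiveProjector_abelianVariety (A : AbelianVariety ℂ) {η : complexBetti A.X 2}
    (hη : IsPolarizationClass A.dim A.X η) {a k : ℕ} (hak : a + 2 + k = A.dim) :
    ∃ P : complexBetti A.X (a + 2) →ₗ[ℂ] complexBetti A.X (a + 2),
      IsAlgebraicCorrespondence A.dim A.dim A.X A.X P ∧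
      (∀ x ∈ primitiveClasses η A.dim (a + 2), P x = x) ∧
      (∀ y : complexBetti A.X a, P (lefschetzPowTo η 1 a (a + 2) (by omega) y) = 0) := by
  have hA : IsSmoothProjective A.dim A.X := AbelianVariety.isSmoothProjective_holds (A := A)
  set g := A.dim with hg
  have hL : HasHardLefschetzProperty η g := hη.hasHardLefschetz
  -- the three algebraic pieces
  set Lpow := lefschetzPowTo η (k + 1) (a + 2) (a + 2 * (k + 2)) (by omega) with hLpow
  set θ : complexBetti A.X (a + 2 * (k + 2)) →ₗ[ℂ] complexBetti A.X a :=
    lefschetzInvolution hL (show a + 2 * (k + 2) + a = 2 * g by omega) with hθ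
  set Lop := lefschetzPowTo η 1 a (a + 2) (by omega) with hLop
  have hLpow_alg : IsAlgebraicCorrespondence g g A.X A.X Lpow :=
    isAlgebraicCorrespondence_lefschetzPowTo hA hη.mem_algebraicClasses (k + 1) (a + 2) _ _ (by omega)
  have hθ_alg : IsAlgebraicCorrespondence g g A.X A.X θ :=
    standardConjectureBStar_abelianVariety A η hη _ _ (show a + 2 * (k + 2) + a = 2 * g by omega)
  have hLop_alg : IsAlgebraicCorrespondence g g A.X A.X Lop :=
    isAlgebraicCorrespondence_lefschetzPowTo hA hη.mem_algebraicClasses 1 a _ _ (by omega)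
  -- `Π = id − Lop ∘ θ ∘ Lpow`
  refine ⟨LinearMap.id - Lop ∘ₗ (θ ∘ₗ Lpow), ?_, fun x hx ↦ ?_, fun y ↦ ?_⟩
  · refine IsAlgebraicCorrespondence.sub hA hA (isAlgebraicCorrespondence_id hA (by omega)) ?_
    exact IsAlgebraicCorrespondence.comp hA hA hA
      (IsAlgebraicCorrespondence.comp hA hA hA hLpow_alg hθ_alg (by omega)) hLop_alg (by omega)
  · -- `x` primitive: `L^{k+1} x = 0`
    have hx0 : Lpow x = 0 := by
      rw [primitiveClasses_eq_ker η g (show a + 2 ≤ g by omega) (show a + 2 + (k + 1) = g + 1 by omega)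
        (show a + 2 + 2 * (k + 1) = a + 2 * (k + 2) by omega)] at hx
      exact hx
    rw [LinearMap.sub_apply, LinearMap.id_apply, LinearMap.comp_apply, LinearMap.comp_apply, hx0, map_zero, map_zero,
      sub_zero]
  · -- `y ∈ H^a`: `L^{k+1} (L y) = L^{k+2} y` and `θ (L^{k+2} y) = y`
    have h1 : Lpow (Lop y) = lefschetzPow η (k + 2) a y := by
      have haux : ∀ (j : ℕ) (h : a + 2 * j = a + 2 * (k + 2)), j = k + 2 →
          lefschetzPowTo η j a (a + 2 * (k + 2)) h y = lefschetzPow η (k + 2) a y := by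
        intro j h hj; subst hj; rfl
      rw [hLpow, hLop, lefschetzPowTo_lefschetzPowTo η (k + 1) (by omega) (by omega)
        (show a + 2 * (1 + (k + 1)) = a + 2 * (k + 2) by omega) y]
      exact haux _ _ (by omega)
    have h2 : θ (lefschetzPow η (k + 2) a y) = y :=
      lefschetzInvolution_lefschetzPow hL (show a + (k + 2) = g by omega) _ y
    rw [LinearMap.sub_apply, LinearMap.id_apply, LinearMap.comp_apply, LinearMap.comp_apply, h1, h2, sub_self]

end Summit.HodgeConjecture.HodgeConjecture.Ring2.AbelianAll

end
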